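import Literature.NumberTheory.EllipticCurves.FunctionFieldSelmer
import Literature.NumberTheory.EllipticCurves.FunctionFieldUnramified
import HarnessLib

/-!
# `Sel^(n)(E/F)` finite ⇐ Milne ADT I.4.15 + I.6.5 over a global function field
# (Silverman AEC X.4.2(b) ⇐ Lemma X.4.3 + Cor. X.4.4): the proved assembly

Third decomposition file (D-0014/D-0026, provefact seat on
`Literature.NumberTheory.EllipticCurves.FunctionField.finite_shaPrimeToChar_torsionBy`, statement
file `FunctionField`, bsd.S33). `FunctionFieldSelmer` reduced that fact to the finiteness of the
`n`-Selmer groups over the global function field `F` (Milne, *ADT*, I.6.4/I.6.7), and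
`FunctionFieldUnramified` set up `H¹(G_F, M; S)` (`h1Unramified`) and the finite
(`finite_badPlaces`) set `badPlaces W`. Here the printed two-step proof of the Selmer finiteness
(Milne, *ADT*, I.§6 Remark 6.7 with Prop. 6.5 and Cor. 4.15; Silverman, *AEC*, X.§4, proof of
Thm. 4.2(b) from Lemma 4.3 and Cor. 4.4; over function fields for `ℓ ≠ p`: Ulmer (2011),
Lecture 1, §5) is **assembled in Lean**, the two deep steps entering as explicit hypotheses
(D-0026: no named fact is minted by this seat):

* `h43` (Milne I.4.15 for `H¹` / Silverman Lemma X.4.3 over `F`): for every finite discrete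
  `Γ_F`-module `M` with continuous action, killed by an integer `n` invertible in `F`, and every
  finite set `S` of places, `H¹(G_F, M; S)` is finite;
* `h44` (Milne I.6.5, first exact sequence, with Lemma 6.1 / Silverman Cor. X.4.4 over `F`): for
  `n` invertible in `F` and `S ⊇ badPlaces W`, `Sel^(n)(E/F) ⊆ H¹(G_F, E[n]; S)`.

Proved: `finite_selmerGroup_of_le_h1Unramified` (`Sel^(n)(E/F)` finite for `n` invertible in
`F`, from `h43`, `h44`, `finite_badPlaces`, `finite_torsionPoints_holds` — `E[n]` finite,
AEC III.6.4 — and `isOpen_stabilizer_point_holds`) and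
`finite_shaPrimeToChar_torsionBy_of_h1Unramified` (the statement-file fact from `h43`, `h44`
under every `𝔽_q`-structure, through `finite_shaPrimeToChar_torsionBy_of_finite_selmerGroup`).
The latter is the glue of the seat's split request: its two hypotheses, verbatim, are the
requested children.

## References

* [MilneADT2006] J. S. Milne, *Arithmetic Duality Theorems*, 2nd ed. (2006), I.§4 Cor. 4.15,
  I.§6 Prop. 6.5, Remark 6.7.
* [SilvermanAEC2009] J. H. Silverman, *The Arithmetic of Elliptic Curves*, 2nd ed., X.§4,
  Thm. 4.2(b), Lemma 4.3, Cor. 4.4.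
* [Ulmer2011ParkCity] D. Ulmer, *Elliptic curves over function fields*, Lecture 1, §5.
-/

noncomputable section

open scoped Classical Polynomial

namespace Literature.NumberTheory.EllipticCurves.FunctionField

open WeierstrassCurve

variable {F : Type} [Field F]

/-! ## Assembly: Selmer finiteness from Milne I.4.15 (X.4.3) and I.6.5 (X.4.4) -/

section Assembly

variable (Fq : Type) [Field Fq] [Fintype Fq] [Algebra Fq[X] F] [Algebra (RatFunc Fq) F]
  [IsScalarTower Fq[X] (RatFunc Fq) F] [FunctionField Fq F] (W : WeierstrassCurve F)

include Fq

/-- **Milne ADT I.6.7 / Silverman X.4.2(b) over a global function field, assembled from its two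
printed steps.** Granted
* `h43` (Milne I.4.15 for `H¹`, Silverman Lemma X.4.3 over `F`): for every finite discrete
  `Γ_F`-module `M` with continuous action, killed by an integer `n` invertible in `F`, and every
  finite set of places `S`, the group `H¹(G_F, M; S)` is finite; and
* `h44` (Milne I.6.5, first sequence / Silverman Cor. X.4.4 over `F`): for `n` invertible in
  `F` and `S ⊇ {bad places}`, `Sel^(n)(E/F) ⊆ H¹(G_F, E[n]; S)`,
the `n`-Selmer group `Sel^(n)(E/F)` is finite for every `n` invertible in `F`: it is a subgroup
of `H¹(G_F, E[n]; S)` for the finite set `S` of bad places (`finite_badPlaces`), `E[n]` being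
finite (`finite_torsionPoints_holds`, AEC III.6.4), discrete (`isOpen_stabilizer_point_holds`)
and killed by `n`. [cite: MilneADT2006, I.§6 Remark 6.7] -/
theorem finite_selmerGroup_of_le_h1Unramified
    (h43 : ∀ (M : Type) [AddCommGroup M] [DistribMulAction (Field.absoluteGaloisGroup F) M]
      [TopologicalSpace M] [DiscreteTopology M] [Finite M]
      [ContinuousSMul (Field.absoluteGaloisGroup F) M] (n : ℤ), (n : F) ≠ 0 →
      (∀ m : M, n • m = 0) → ∀ {S : Set (Place F)}, S.Finite → Finite (h1Unramified M S))
    (h44 : ∀ [W.IsElliptic] {n : ℤ}, (n : F) ≠ 0 → ∀ {S : Set (Place F)}, badPlaces W ⊆ S →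
      selmerGroup W n ≤ h1Unramified (geomTorsion W n) S)
    [W.IsElliptic] {n : ℤ} (hn : (n : F) ≠ 0) : Finite (selmerGroup W n) := by
  have hn0 : n ≠ 0 := by
    rintro rfl
    exact hn (by simp)
  haveI : Finite (geomTorsion W n) := finite_torsionPoints_holds W (AlgebraicClosure F) hn0
  haveI : ContinuousSMul (Field.absoluteGaloisGroup F) (geomTorsion W n) :=
    continuousSMul_geomTorsion W (isOpen_stabilizer_point_holds W) n
  have hkill : ∀ P : geomTorsion W n, n • P = 0 := fun P =>
    Subtype.ext (by
      rw [AddSubgroup.coe_zsmul, AddSubgroup.coe_zero]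
      exact (Submodule.mem_torsionBy_iff n (P : geomPoints W)).mp P.2)
  have hfin : Finite (h1Unramified (geomTorsion W n) (badPlaces W)) :=
    h43 _ n hn hkill (finite_badPlaces Fq W)
  exact Finite.of_injective _ (AddSubgroup.inclusion_injective (h44 hn subset_rfl))

end Assembly

/-- **The statement-file fact `finite_shaPrimeToChar_torsionBy` from Milne I.4.15 and I.6.5 over
`F`** (the seat's split glue, proved): under every `𝔽_q`-structure on `F`, finiteness of
`H¹(G_F, M; S)` (`h43`, Silverman X.4.3 / Milne I.4.15 shape) and unramifiedness of Selmer
classes outside the bad places (`h44`, Silverman X.4.4 / Milne I.6.5 shape) give the finiteness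
of `Sel^(n)(E/F)` (`finite_selmerGroup_of_le_h1Unramified`), hence of `Ш(E/F)[n]` and of
`Ш(E/F)[p'][n]` (`finite_shaPrimeToChar_torsionBy_of_finite_selmerGroup`, Milne I.6.4/I.6.7).
[cite: MilneADT2006, I.§6 Remark 6.7] -/
theorem finite_shaPrimeToChar_torsionBy_of_h1Unramified (W : WeierstrassCurve F)
    (h43 : ∀ (Fq : Type) [Field Fq] [Fintype Fq] [Algebra Fq[X] F] [Algebra (RatFunc Fq) F]
      [IsScalarTower Fq[X] (RatFunc Fq) F] [FunctionField Fq F]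
      (M : Type) [AddCommGroup M] [DistribMulAction (Field.absoluteGaloisGroup F) M]
      [TopologicalSpace M] [DiscreteTopology M] [Finite M]
      [ContinuousSMul (Field.absoluteGaloisGroup F) M] (n : ℤ), (n : F) ≠ 0 →
      (∀ m : M, n • m = 0) → ∀ {S : Set (Place F)}, S.Finite → Finite (h1Unramified M S))
    (h44 : ∀ (Fq : Type) [Field Fq] [Fintype Fq] [Algebra Fq[X] F] [Algebra (RatFunc Fq) F]
      [IsScalarTower Fq[X] (RatFunc Fq) F] [FunctionField Fq F] [W.IsElliptic] {n : ℤ},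
      (n : F) ≠ 0 → ∀ {S : Set (Place F)}, badPlaces W ⊆ S →
      selmerGroup W n ≤ h1Unramified (geomTorsion W n) S) :
    finite_shaPrimeToChar_torsionBy W :=
  finite_shaPrimeToChar_torsionBy_of_finite_selmerGroup W fun Fq _ _ _ _ _ _ _ _ hn =>
    finite_selmerGroup_of_le_h1Unramified Fq W (h43 Fq) (h44 Fq) hn

end Literature.NumberTheory.EllipticCurves.FunctionField

end
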